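import Summits.QuantumFields.BalabanUV.Beta.CombChartJointEndReflTablesAn1S2N
import Summits.QuantumFields.BalabanUV.Beta.SymTablesAn1FirstOrder
import Summits.QuantumFields.BalabanUV.Beta.CombChartWardSockets
import Summits.QuantumFields.BalabanUV.Beta.CombChartContactFactor
import Summits.QuantumFields.BalabanUV.Beta.SecondOrderRemainderTables
import Summits.QuantumFields.BalabanUV.Beta.SymmetrisedStepJetsParity
import Summits.QuantumFields.BalabanUV.Beta.SpineRecursiveParity
import Summits.QuantumFields.BalabanUV.Beta.ChartConjugationRelative
import Summits.QuantumFields.BalabanUV.Beta.KernelWardRelative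

/-!
# `BalabanUV.Beta.CombRemainderTadpoleSlot` — binder row D1, chart (III′), programme P5, brick P5-a: **ROOT M″'s SCALAR `hRm0` REDUCES TO THE
# T2-REMAINDER SLOT** — of the four words of the W-remainder `Rm_j` of the (III′) repair track (the split defect `combΔAn1` of
# `CombSecondOrderRemainderAn1`, explicit by `CombSecondOrderDeltaSep.combΔOfAt_eq_sharp`), THREE have ZERO tadpole against the comb-chart resolvent
# `G′_j = GcombSh Lc j` by theorems: the second-order contact mismatch `conjV 𝕄_j (diagK X♯)` (relative-inverse trace rules), the contact-kernel vertex
# `dM (−G′ΞG′) S_j M1_j` (first-order row parity), and the MIXED remainder slot — because an2-g31's mixed reflection remainder `symRMrAn1` IS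
# ROW-PARITY-ODD AT THE LOCK `hΛ : cΛ·Lc⁴ = 2` with the pinned `γ_j` (§1; the (III′)∕an1 twin of an2-g28's `MixedLetterPacking.parityOdd_RMof`).
# Hence `tadpole G′_j (Rm_j α μ y ν y′) = ½·(tadpole G′_j (vertex2OfK G′_j Lc (combR2An1 … j α) μ y ν y′) + (μy ↔ νy′))` (§5) and ROOT M″
# (`CombChartJointEndReflTablesAn1S2N`) holds with `hRm0` replaced by the displayed T2-remainder slot identity `hR2tad` (§6).

HONEST FRAMING (cell contract, verbatim): «discharging `BetaPertH` makes Bałaban's UV stability UNCONDITIONAL — a real constructive-QFT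
result; it is NOT the continuum limit and NOT the Clay problem.»  HONEST DEPENDENCY: continuum YM on T⁴ ⇐ BetaPertH ∧ nine spine estimates (0/9 proved);
BetaPertH ⇐ (D1) ∧ (D4) ∧ CAP+tail; G-an2-4 gates asym, D1 and NE2/3/4.
DERIVED cell leaf ([folklore] kernel algebra over OUR typed objects BY NAME; β sub-cell, BINDER-OWNERS row D1 OWNER `b2b-balaban-beta-an2` gen 38).  No statement
of Bałaban's papers, no `[cite:]`, no `Prop` fact, no `def`.  WHAT THIS IS: a REDUCTION of the one displayed scalar of the repair track — `hR2tad` is the SAME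
open scalar as `hRm0` read on ONE table (an2's recursive T2-remainder `combR2An1`), NOT a discharge; it is Engine C's (E0) object (R-D1-HRM0-E0,
`ttrl/requests.jsonl` l.2727 ∕ l.2763) with three of its four words certified null in the kernel.  WHAT THIS IS NOT: no binder of the row is discharged
(row-D1 binders 0∕4, repair-track classes 0∕4); the ROOT OF RECORD is the referee's to name (M′∕N p303989 → M″ p322701 per REFEREE #80∕#84∕#85);
NOT D1, NOT `BetaPertH`, NOT continuum, NOT Clay.

WHAT (`d + 1 = 4`):
* §1 `symRMrAn1_apply` (entrywise form), **`trK_symRMrAn1`**: `trK (symRMrAn1 Lc cΛ γ j α κ u ρ w) = −sgnK (…)` at the weight lock `cΛ·wM1_j·γ_j = −wM2_j`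
  (`symHessFFAt` lives on the field–field block and is parity-odd there, `SymTablesAn1FirstOrder.trK_symHessFFAt`; the comb generator `ctGen` and the
  border-reading generator `ctGenM (bhK + Dsh)` have THE SAME field leg; at the lock the scalar coefficient is symmetric in the two legs).
* §2 `tadpole_mixOfK_symRMrAn1_eq_zero` (leaf-05's `SecondOrderRemainderTables.tadpole_mixOfK_eq_zero` + `CombChartWardSockets.trK_GcombSh` + §1).
* §3 `tadpole_conjV_bhKStepSh_eq_zero` ∕ `…_diagK_eq_zero`: `tadpole G′_j (conjV 𝕄_j Y) = 0` for localised `Y` commuting with the coordinate slice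
  (`ChartConjugationRelative.trace_KHY_rel` ∕ `trace_KYH_rel` at `RelInvCombShiftedSpread.relInv_coDressKAt_Gsym_bhKStepSh`; `DiagonalContact.comp_axEc_diagK_comm`).
* §4 `tadpole_dM_SpureRecOf_eq_zero` (an1∕leaf-05's `SpineRecursiveParity.tadpole_dM_eq_zero_of_rows`, `SymmetrisedStepJetsParity.trK_SpureRecOf` at `GcombSh`,
  `SymTablesAn1FirstOrder.trK_M1Of_symHessFFAt`).
* §5 `lock_of_hΛ` (`hΛ` ⟹ the weight lock at the pinned `γ_j`), **`tadpole_combΔAn1_pinned_eq`**, **`tadpole_Rm_pinned_eq`**, **`hRm0_of_hR2tad`** (M″'s `hRm0` VERBATIM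
  from `hR2tad`).
* §6 **`d1Drift_JsB12CombShSym_an1TablesS2_pinned_of_locks_hR2tad_D1Tel_D1Rep`**: ROOT M″ with `hRm0 ↦ hR2tad`, everything else verbatim.
Provenance: β sub-cell, unit beta-an2 gen 38, 2026-08-22 (v1); over `CombChartJointEndReflTablesAn1S2N` (M″, gen 37), `CombSecondOrderDeltaSep` ∕ `…RemainderAn1` (gen 36∕37),
`SymMixedReflectionLetterAn1` (gen 31), an1∕leaf seats' `SymTablesAn1FirstOrder`, `SecondOrderRemainderTables`, `SpineRecursiveParity`, `SymmetrisedStepJetsParity`,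
`ChartConjugationRelative`, `SecondOrderSplitLoc`, `SecondOrderSeparationCalculus` BY NAME; no existing file touched.
-/

noncomputable section

open Finset
open scoped BigOperators
open Literature.MathematicalPhysics.QuantumFieldTheory
open Literature.MathematicalPhysics.QuantumFieldTheory.Balaban1983to89
open Literature.MathematicalPhysics.QuantumFieldTheory.Balaban1983to89.Beta
open B12Sec2to5 (l1 l1_nonneg)
open ExpKernelCalculus (MKer Decays BiLoc VertexFamily comp tr tadpole)
open PolarizationSign (reflSign)
open KernelReflection (refK)
open ResolventReflection (bref Φ)
open AveragingContoursRooted (ctr ctrOff ctrOff_mem_box)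
open Literature.MathematicalPhysics.QuantumFieldTheory.Balaban1983to89.Beta.VectorTailsLoc (fam kfam)
open Literature.MathematicalPhysics.QuantumFieldTheory.Balaban1983to89.Beta.VectorLegVolumeAdapter (MvE)
open OneStepResolventKernel (Fib LocStencil JetData decays_mono)
open OneStepKernelFamily (D1Tel D1Rep D1Drift)
open OneStepKernelFamily (colH vertexOfK)
open BalabanStepJetsSucc (wVH)
open BalabanStepW2 (M2Of wM1 wM2 wV4)
open BalabanCompositeJets (LocStencil₂)
open SecondOrderResponse (dM K2OfK vertex2OfK mixOfK W2OfK LocStencilFM)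
open WilsonVertex2Sym (wsym22)
open Summit.QuantumFields.BalabanUV.Beta.TameKernelCalculus
open Summit.QuantumFields.BalabanUV.Beta.ChartConjugation (conjV conjW conjW₁ conjW₂ loc_conjV)
open Summit.QuantumFields.BalabanUV.Beta.KernelWardRelative (conjV_zero)
open Summit.QuantumFields.BalabanUV.Beta.SecondOrderSplitLoc (loc_dM_Xi_dressed)
open Summit.QuantumFields.BalabanUV.Beta.SecondOrderSeparationCalculus (sep_vertex2OfK sep_mixOfK sep_mixOfK_swap)
open Summit.QuantumFields.BalabanUV.Beta.SymSecondOrderClassStep (pkg_of_spr)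
open Summit.QuantumFields.BalabanUV.Beta.CombSecondOrderDeltaSep (hΔL_pinned)
open KernelReflection (tadpole_smul)
open Summit.QuantumFields.BalabanUV.Beta.ChartConjugationRelative (RelInv trace_KHY_rel trace_KYH_rel)
open Summit.QuantumFields.BalabanUV.Beta.AxialDressingRooted (one_le_of_neZero axEc spr_axEc)
open Summit.QuantumFields.BalabanUV.Beta.SymShiftedSpread (bhKStepSh spr_bhKStepSh)
open Summit.QuantumFields.BalabanUV.Beta.BorderedHessian (sgnK sgnK_apply sgnF sgnF_inl sgnF_inr bhK spr_bhK stepScale diagK diagK_apply comp_diagK_left comp_diagK_right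
  conjV_diagK_apply comp_axEc_diagK_comm ctGen ctGen_inl)
open Summit.QuantumFields.BalabanUV.Beta.SymSecondOrderSplitLoc (locStencil₂_diagK_ctGenM_mul_ctGenM)
open Summit.QuantumFields.BalabanUV.Beta.E3ContactGenerator (ctGenM ctGenM_inl)
open Summit.QuantumFields.BalabanUV.Beta.DshAn1 (Dsh spr_Dsh)
open Summit.QuantumFields.BalabanUV.Beta.RelInvNullShift (spr_add)
open Summit.QuantumFields.BalabanUV.Beta.SpineRooted (M1Of_apply)
open Summit.QuantumFields.BalabanUV.Beta.SymAveragingHessianCounts (symVhSAt symHessFFAt symLinKerAt symVhSAt_hV_ctr symHessFFAt_hH_ctr)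
open Summit.QuantumFields.BalabanUV.Beta.SymAveragingMixedJetTables (symMixFFAt)
open Summit.QuantumFields.BalabanUV.Beta.SymSecondOrderTablesAn1 (symVh₂SAn1 symTablesAn1S2)
open Summit.QuantumFields.BalabanUV.Beta.CombChartJointEnd (JsB12CombShSym)
open Summit.QuantumFields.BalabanUV.Beta.CombChartJointEndReflTablesAn1S2N (d1Drift_JsB12CombShSym_an1TablesS2_pinned_of_locks_hcomp_D1Tel_D1Rep)
open Summit.QuantumFields.BalabanUV.Beta.SymMixedReflectionLetterAn1 (symRMrAn1)
open Summit.QuantumFields.BalabanUV.Beta.SymMixedRemainderClass (locStencilFM_symRMrAn1)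
open Summit.QuantumFields.BalabanUV.Beta.SymTablesAn1FirstOrder (trK_symVhSAt trK_symHessFFAt trK_M1Of_symHessFFAt)
open Summit.QuantumFields.BalabanUV.Beta.SymmetrisedStepJetsParity (trK_SpureRecOf)
open Summit.QuantumFields.BalabanUV.Beta.SpineRecursiveParity (parityOdd_smul tadpole_dM_eq_zero_of_rows)
open Summit.QuantumFields.BalabanUV.Beta.SecondOrderRemainderTables (tadpole_mixOfK_eq_zero loc_vertex2OfK loc_mixOfK)
open Summit.QuantumFields.BalabanUV.Beta.CombChartStepJets (GcombSh decays_GcombSh)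
open Summit.QuantumFields.BalabanUV.Beta.CombChartWardSockets (trK_GcombSh)
open Summit.QuantumFields.BalabanUV.Beta.CombChartContactFactor (spr_GcombSh)
open Summit.QuantumFields.BalabanUV.Beta.RelInvCombShiftedSpread (relInv_coDressKAt_Gsym_bhKStepSh)
open Summit.QuantumFields.BalabanUV.Beta.SpineRooted (M1Of SpureRecOf T2RecOf)
open Summit.QuantumFields.BalabanUV.Beta.CombSecondOrderRemainderAn1 (combΔOfAt combR2An1 combΔAn1)
open Summit.QuantumFields.BalabanUV.Beta.CombSecondOrderDeltaSep (comb_letters_common combΔOfAt_eq_sharp locStencil₂_combR2An1)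
open Summit.QuantumFields.BalabanUV.Beta.SymSecondOrderDeltaSep (sep_diagK_sharpSymbol sep_zeroTable)

namespace Summit.QuantumFields.BalabanUV.Beta.CombRemainderTadpoleSlot

variable {Lc : ℕ} [NeZero Lc]

/-! ## §1 The mixed reflection remainder `symRMrAn1` entrywise, and its row parity at the weight lock -/

omit [NeZero Lc] in
open Classical in
/-- [folklore] **`symRMrAn1` ENTRYWISE**: a scalar multiple of an1's sym W-Hessian table `symHessFFAt ρ_c Lc ρ w`, the scalar reading the comb generator
`ctGen` at the ROW leg, the rank-one letter, and the root's border-reading generator `γ_j·ctGenM (bhK + Dsh)` at BOTH legs (`comp_diagK_left`,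
`conjV_diagK_apply`, `M1Of_apply`). -/
theorem symRMrAn1_apply (cΛ : ℝ) (γ : ℕ → ℝ) (j : ℕ) (α κ : Fin 4) (u : Fin 4 → ℤ) (ρ : Fin 4) (w : Fin 4 → ℤ) (x z : Fin 4 → ℤ) (a b : Fib 3) :
    symRMrAn1 Lc cΛ γ j α κ u ρ w x z a b =
      (wM2 3 Lc j * (2 * ctGen 3 α Lc κ u x a + 2 * (if ρ = α then symLinKerAt (ctr 4 Lc) Lc ρ w (κ, u) else 0)) +
          cΛ * wM1 3 Lc j * (γ j * ctGenM 3 (bhK Lc + Dsh Lc) α Lc κ u x a - γ j * ctGenM 3 (bhK Lc + Dsh Lc) α Lc κ u z b)) *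
        symHessFFAt (ctr 4 Lc) Lc ρ w x z a b := by
  simp only [symRMrAn1, Pi.sub_apply, Pi.add_apply, Pi.smul_apply, smul_eq_mul, comp_diagK_left, conjV_diagK_apply, M1Of_apply]
  ring

omit [NeZero Lc] in
/-- [folklore] **THE MIXED REFLECTION REMAINDER IS ROW-PARITY-ODD AT THE WEIGHT LOCK** `cΛ·wM1_j·γ_j = −wM2_j` (the (III′)∕an1 twin of
`MixedLetterPacking.parityOdd_RMof`): `symHessFFAt` lives on the field–field block and is parity-odd there (`trK_symHessFFAt`), the two generators
have THE SAME field leg (`ctGen_inl` = `ctGenM_inl`), and at the lock the scalar coefficient becomes symmetric in the two legs. -/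
theorem trK_symRMrAn1 {cΛ : ℝ} {γ : ℕ → ℝ} {j : ℕ} (hw : cΛ * wM1 3 Lc j * γ j = -wM2 3 Lc j) (α κ : Fin 4) (u : Fin 4 → ℤ) (ρ : Fin 4)
    (w : Fin 4 → ℤ) : trK (symRMrAn1 Lc cΛ γ j α κ u ρ w) = -sgnK (symRMrAn1 Lc cΛ γ j α κ u ρ w) := by
  classical
  funext x z a b
  have e := congrArg (fun K => K x z a b) (trK_symHessFFAt (ctr 4 Lc) Lc ρ w)
  simp only [trK_apply, Pi.neg_apply, sgnK_apply] at e
  simp only [trK_apply, Pi.neg_apply, sgnK_apply]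
  rw [symRMrAn1_apply, symRMrAn1_apply, e]
  rcases a with β | m <;> rcases b with β' | m'
  · rw [ctGen_inl, ctGen_inl, ctGenM_inl, ctGenM_inl]
    have hw' : cΛ * wM1 3 Lc j * γ j + wM2 3 Lc j = 0 := by rw [hw]; ring
    set F1 : ℝ := (if x = u ∧ β = κ ∧ κ = α then (-1 : ℝ) else 0) with hF1
    set F2 : ℝ := (if z = u ∧ β' = κ ∧ κ = α then (-1 : ℝ) else 0) with hF2
    linear_combination (2 * (F1 - F2) * (sgnF (d := 3) (Sum.inl β) * sgnF (d := 3) (Sum.inl β') *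
      symHessFFAt (ctr 4 Lc) Lc ρ w x z (Sum.inl β) (Sum.inl β'))) * hw'
  · simp
  · simp
  · simp

/-! ## §2 The mixed remainder slot has zero tadpole against the comb-chart resolvent -/

/-- [folklore] **THE MIXED-SLOT WORD OF `symRMrAn1` HAS ZERO TADPOLE AGAINST `G′_j`** at the weight lock: leaf-05's `tadpole_mixOfK_eq_zero` (spread
sgn-symmetric `G′_j` — `spr_GcombSh`, `trK_GcombSh`; decaying weight kernel `G′_j`; `LocStencilFM` class `locStencilFM_symRMrAn1`; row parity §1). -/
theorem tadpole_mixOfK_symRMrAn1_eq_zero {cΛ : ℝ} {γ : ℕ → ℝ} {j : ℕ} (hw : cΛ * wM1 3 Lc j * γ j = -wM2 3 Lc j) (α μ : Fin 4) (y : Fin 4 → ℤ)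
    (ν : Fin 4) (y' : Fin 4 → ℤ) :
    tadpole (GcombSh Lc j) (mixOfK (GcombSh (d := 3) Lc j) Lc (symRMrAn1 Lc cΛ γ j α) μ y ν y') = 0 := by
  obtain ⟨δ, C, hδ, hC, hG⟩ := decays_GcombSh (d := 3) Lc j
  obtain ⟨CM, δM, hδM, hRM⟩ := locStencilFM_symRMrAn1 (Lc := Lc) cΛ γ j α
  have hm : 0 < min δ δM := lt_min hδ hδM
  exact tadpole_mixOfK_eq_zero (spr_GcombSh (d := 3) (Lc := Lc) j) (trK_GcombSh (d := 3) (Lc := Lc) j)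
    (decays_mono hG hC le_rfl (min_le_left _ _)) hC hm (hRM.mono (min_le_right _ _)) (fun κ u ρ w => trK_symRMrAn1 hw α κ u ρ w) μ y ν y'

/-! ## §3 The second-order contact mismatch has zero tadpole (relative-inverse trace rules) -/

/-- [folklore] **`tadpole G′_j (conjV 𝕄_j Y) = 0` FOR A LOCALISED `Y` COMMUTING WITH THE COORDINATE SLICE** — the `X₂`-immateriality inside
`ChartConjugationRelative.tadpole_conjW₂_rel`, isolated: `tr(G′(𝕄Y)) − tr(G′(Y𝕄)) = tr(EY) − tr(EY)` by `trace_KHY_rel` ∕ `trace_KYH_rel` at the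
(III′) relative-inverse triple (`relInv_coDressKAt_Gsym_bhKStepSh`). -/
theorem tadpole_conjV_bhKStepSh_eq_zero (j : ℕ) {Y : MKer 4 (Fib 3)} (hY : Loc Y)
    (hEY : comp (axEc (ctr 4 Lc) Lc) Y = comp Y (axEc (ctr 4 Lc) Lc)) :
    tadpole (GcombSh Lc j) (conjV (bhKStepSh 3 Lc (Dsh Lc) j) Y) = 0 := by
  have hL1 : 1 ≤ Lc := one_le_of_neZero Lc
  have hA : Spr (GcombSh (d := 3) Lc j) := spr_GcombSh (d := 3) (Lc := Lc) j
  have hM : Spr (bhKStepSh 3 Lc (Dsh Lc) j) := spr_bhKStepSh (spr_Dsh hL1) j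
  have hE : Spr (axEc (d := 3) (ctr 4 Lc) Lc) := spr_axEc _ _
  have hR : RelInv (GcombSh (d := 3) Lc j) (bhKStepSh 3 Lc (Dsh Lc) j) (axEc (ctr 4 Lc) Lc) := relInv_coDressKAt_Gsym_bhKStepSh (d := 3) (Lc := Lc) j
  have h1 := trace_KHY_rel hA hM hE hR hY hEY
  have h2 := trace_KYH_rel hA hM hE hR hY hEY
  unfold ExpKernelCalculus.tadpole
  rw [show conjV (bhKStepSh 3 Lc (Dsh Lc) j) Y = comp (bhKStepSh 3 Lc (Dsh Lc) j) Y - comp Y (bhKStepSh 3 Lc (Dsh Lc) j) from rfl,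
    comp_sub_right_tame hA.tame (hM.comp_loc hY).tame (hY.comp_spr hM).tame, tr_sub_loc (hA.comp_loc (hM.comp_loc hY)) (hA.comp_loc (hY.comp_spr hM)),
    h1, h2, sub_self]

/-- [folklore] **… IN PARTICULAR FOR EVERY LOCALISED DIAGONAL CONTACT** (`DiagonalContact.comp_axEc_diagK_comm`). -/
theorem tadpole_conjV_bhKStepSh_diagK_eq_zero (j : ℕ) {g : (Fin 4 → ℤ) → Fib 3 → ℝ} (hg : Loc (diagK g)) :
    tadpole (GcombSh Lc j) (conjV (bhKStepSh 3 Lc (Dsh Lc) j) (diagK g)) = 0 :=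
  tadpole_conjV_bhKStepSh_eq_zero j hg (comp_axEc_diagK_comm _ _ _)

/-! ## §4 The contact-kernel vertex has zero tadpole (first-order row parity) -/

/-- [folklore] **`tadpole G′_j (dM K′ Lc S_j M1_j μ y) = 0` FOR ANY WEIGHT KERNEL `K′`** once the word is localised: an1∕leaf-05's
`tadpole_dM_eq_zero_of_rows` with the row parities of `S_j = SpureRecOf …` (`trK_SpureRecOf` at `G := GcombSh Lc`) and `M1_j` (`trK_M1Of_symHessFFAt`). -/
theorem tadpole_dM_SpureRecOf_eq_zero (cΛ : ℝ) (j : ℕ) (K' : MKer 4 (Fib 3)) (μ : Fin 4) (y : Fin 4 → ℤ)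
    (hl : Loc (dM K' Lc (SpureRecOf 3 Lc (symVhSAt (ctr 4 Lc) 3 Lc rfl) (symHessFFAt (ctr 4 Lc) Lc) (GcombSh Lc) ((Lc : ℝ) ^ 4) (-((Lc : ℝ) ^ 8 / 2)) cΛ j)
      (M1Of 3 Lc (symHessFFAt (ctr 4 Lc) Lc) cΛ j) μ y)) :
    tadpole (GcombSh Lc j) (dM K' Lc (SpureRecOf 3 Lc (symVhSAt (ctr 4 Lc) 3 Lc rfl) (symHessFFAt (ctr 4 Lc) Lc) (GcombSh Lc) ((Lc : ℝ) ^ 4) (-((Lc : ℝ) ^ 8 / 2)) cΛ j)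
      (M1Of 3 Lc (symHessFFAt (ctr 4 Lc) Lc) cΛ j) μ y) = 0 := by
  have hL1 : 1 ≤ Lc := one_le_of_neZero Lc
  exact tadpole_dM_eq_zero_of_rows (spr_GcombSh (d := 3) (Lc := Lc) j) (trK_GcombSh (d := 3) (Lc := Lc) j) K' Lc
    (fun κ u => trK_SpureRecOf (d := 3) (symVhSAt_hV_ctr (d := 3) hL1) (symHessFFAt_hH_ctr (d := 3) hL1) (decays_GcombSh Lc)
      (fun j' => trK_GcombSh (d := 3) (Lc := Lc) j') (fun κ u => trK_symVhSAt _ _ κ u) (fun μ y => trK_symHessFFAt _ _ μ y) _ _ cΛ j κ u)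
    (fun ρ w => trK_M1Of_symHessFFAt (d := 3) _ cΛ j ρ w) μ y hl

/-! ## §5 The reduction: `tadpole G′_j (combΔAn1 …) = tadpole G′_j (T2-remainder slot)`, and ROOT M″'s `hRm0` from the slot identity alone -/

omit [NeZero Lc] in
/-- [folklore] Two `conjW` words differing only in the second-order contact slot differ by the commutator of the difference. -/
theorem conjW_sub_conjW (M V Vp X Xp A B : MKer 4 (Fib 3)) :
    conjW M V Vp X Xp A - conjW M V Vp X Xp B = conjV M A - conjV M B := by
  simp only [conjW, conjW₂, conjV]
  abel

omit [NeZero Lc] in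
/-- [folklore] The pinned (zero) second-order contact table gives the zero diagonal kernel. -/
theorem diagK_zeroTable (j : ℕ) (α μ : Fin 4) (y : Fin 4 → ℤ) (ν : Fin 4) (y' : Fin 4 → ℤ) :
    (diagK fun p a => (0 : ℕ → Fin 4 → Fin 4 → (Fin 4 → ℤ) → Fin 4 → (Fin 4 → ℤ) → (Fin 4 → ℤ) → Fib 3 → ℝ) j α μ y ν y' p a) = 0 := by
  funext x z a b
  simp [diagK_apply]

omit [NeZero Lc] in
/-- [folklore] … and so does the antisymmetrised pinned table of ROOT M″'s remainder. -/
theorem diagK_zeroTable_sub (j : ℕ) (α μ : Fin 4) (y : Fin 4 → ℤ) (ν : Fin 4) (y' : Fin 4 → ℤ) :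
    (diagK fun p a => (0 : ℕ → Fin 4 → Fin 4 → (Fin 4 → ℤ) → Fin 4 → (Fin 4 → ℤ) → (Fin 4 → ℤ) → Fib 3 → ℝ) j α ν y' μ y p a -
      (0 : ℕ → Fin 4 → Fin 4 → (Fin 4 → ℤ) → Fin 4 → (Fin 4 → ℤ) → (Fin 4 → ℤ) → Fib 3 → ℝ) j α μ y ν y' p a) = 0 := by
  funext x z a b
  simp [diagK_apply]

/-- [folklore] **THE WEIGHT LOCK FROM ROOT M″'s LOCK `hΛ` AT THE PINNED `γ_j`**: `cΛ·wM1_j·γ_j = −wM2_j` for `γ_j = −(Lc⁸∕2)·wVH_j∕(stepScale_j·Lc⁴)`,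
`cΛ·Lc⁴ = 2` (the weights are `(Lc^j)^{10}`, `(Lc^j)^{10}`, `(Lc^j)^{5}`, `(Lc^j)^{15}`). -/
theorem lock_of_hΛ {cΛ : ℝ} (hΛ : cΛ * (Lc : ℝ) ^ 4 = 2) (j : ℕ) :
    cΛ * wM1 3 Lc j * ((fun j => -((Lc : ℝ) ^ 8 / 2) * wVH 3 Lc j / (stepScale 3 Lc j * (Lc : ℝ) ^ 4)) j) = -wM2 3 Lc j := by
  have hL : (Lc : ℝ) ≠ 0 := by exact_mod_cast NeZero.ne Lc
  have hq : ((Lc : ℝ) ^ j) ≠ 0 := pow_ne_zero _ hL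
  have hc : cΛ = 2 / (Lc : ℝ) ^ 4 := by rw [eq_div_iff (pow_ne_zero _ hL)]; exact hΛ
  simp only [BalabanStepW2.wM1, BalabanStepW2.wM2, BalabanStepJetsSucc.wVH, BorderedHessian.stepScale, hc]
  field_simp
  ring

/-- [folklore] **THE REDUCTION AT THE PIN `X2s := 0`**: at the weight lock, for every `N`, level `j`, axis `α` and bond pair,
`tadpole G′_j (combΔAn1 … 0 j α μ y ν y′) = tadpole G′_j (vertex2OfK G′_j Lc (combR2An1 … 0 j α) μ y ν y′)` — the contact mismatch (§3), the
contact-kernel vertex (§4) and the two mixed remainder slots (§2) drop out of the tadpole. -/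
theorem tadpole_combΔAn1_pinned_eq {cΛ : ℝ} {γ : ℕ → ℝ} (hw : ∀ j, cΛ * wM1 3 Lc j * γ j = -wM2 3 Lc j) (N j : ℕ) (α μ : Fin 4) (y : Fin 4 → ℤ)
    (ν : Fin 4) (y' : Fin 4 → ℤ) :
    tadpole (GcombSh Lc j) (combΔAn1 Lc N cΛ γ (0 : ℕ → Fin 4 → Fin 4 → (Fin 4 → ℤ) → Fin 4 → (Fin 4 → ℤ) → (Fin 4 → ℤ) → Fib 3 → ℝ) j α μ y ν y') =
      tadpole (GcombSh Lc j) (vertex2OfK (GcombSh (d := 3) Lc j) Lc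
        (combR2An1 Lc N cΛ γ (0 : ℕ → Fin 4 → Fin 4 → (Fin 4 → ℤ) → Fin 4 → (Fin 4 → ℤ) → (Fin 4 → ℤ) → Fib 3 → ℝ) j α) μ y ν y') := by
  have hL1 : 1 ≤ Lc := one_le_of_neZero Lc
  have hA : Spr (GcombSh (d := 3) Lc j) := spr_GcombSh (d := 3) (Lc := Lc) j
  have hM : Spr (bhKStepSh 3 Lc (Dsh Lc) j) := spr_bhKStepSh (spr_Dsh hL1) j
  -- the letter classes at one common rate, and their existential packages
  obtain ⟨m, C, Cs, CM, Cg, hm, hC, hG, hS, hM1, hgl⟩ := comb_letters_common (Lc := Lc) cΛ γ j α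
  have hK : ∃ δ C : ℝ, 0 < δ ∧ 0 ≤ C ∧ Decays (GcombSh (d := 3) Lc j) C δ := ⟨m, C, hm, hC, hG⟩
  have h𝕄 : ∃ δ C : ℝ, 0 < δ ∧ 0 ≤ C ∧ Decays (bhKStepSh 3 Lc (Dsh Lc) j) C δ := pkg_of_spr hM
  have hS' : ∃ Cs δs : ℝ, 0 < δs ∧ LocStencil (SpureRecOf 3 Lc (symVhSAt (ctr 4 Lc) 3 Lc rfl) (symHessFFAt (ctr 4 Lc) Lc) (GcombSh Lc) ((Lc : ℝ) ^ 4) (-((Lc : ℝ) ^ 8 / 2)) cΛ j) Cs δs := ⟨Cs, m, hm, hS⟩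
  have hM' : ∃ CM δM : ℝ, 0 < δM ∧ VertexFamily (M1Of 3 Lc (symHessFFAt (ctr 4 Lc) Lc) cΛ j) Lc CM δM := ⟨CM, m, hm, hM1⟩
  have hgl' : ∃ Cg δg : ℝ, 0 < δg ∧ LocStencil (fun κ u => diagK fun p a => γ j * ctGenM 3 (bhK Lc + Dsh Lc) α Lc κ u p a) Cg δg := ⟨Cg, m, hm, hgl⟩
  obtain ⟨δB, CB, hδB, hCB, hBd⟩ := pkg_of_spr (spr_add (spr_bhK (d := 3) hL1) (spr_Dsh hL1))
  have hhl : ∃ Ch δh : ℝ, 0 < δh ∧ LocStencil₂ (fun κ u κ' u' => diagK fun p a =>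
      (γ j * ctGenM 3 (bhK Lc + Dsh Lc) α Lc κ u p a) * (γ j * ctGenM 3 (bhK Lc + Dsh Lc) α Lc κ' u' p a)) Ch δh :=
    ⟨_, δB / 3, by positivity, locStencil₂_diagK_ctGenM_mul_ctGenM hBd hδB.le (γ j) (γ j) α Lc⟩
  have hR2 : ∃ C δ : ℝ, 0 < δ ∧ LocStencil₂ (combR2An1 Lc N cΛ γ (0 : ℕ → Fin 4 → Fin 4 → (Fin 4 → ℤ) → Fin 4 → (Fin 4 → ℤ) → (Fin 4 → ℤ) → Fib 3 → ℝ) j α) C δ :=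
    locStencil₂_combR2An1 (Lc := Lc) N cΛ γ 0 α (fun j' => sep_zeroTable (Lc := Lc) j' α) j
  -- localisation of the four surviving words
  obtain ⟨CX, δX, hδX, hXs⟩ := sep_diagK_sharpSymbol (N := Lc) hK h𝕄 hS' hM' hgl' hhl
  have hLX : Loc (diagK fun p c => (∑ κ, ∑' u, colH (GcombSh (d := 3) Lc j) Lc μ y κ u * ∑ κ', ∑' u', colH (GcombSh (d := 3) Lc j) Lc ν y' κ' u' *
      ((γ j * ctGenM 3 (bhK Lc + Dsh Lc) α Lc κ u p c) * (γ j * ctGenM 3 (bhK Lc + Dsh Lc) α Lc κ' u' p c))) +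
      ∑ κ, ∑' u, colH (K2OfK (GcombSh Lc j) Lc (SpureRecOf 3 Lc (symVhSAt (ctr 4 Lc) 3 Lc rfl) (symHessFFAt (ctr 4 Lc) Lc) (GcombSh Lc) ((Lc : ℝ) ^ 4) (-((Lc : ℝ) ^ 8 / 2)) cΛ j) (M1Of 3 Lc (symHessFFAt (ctr 4 Lc) Lc) cΛ j) ν y' +
        -(comp (comp (GcombSh Lc j) (conjV (bhKStepSh 3 Lc (Dsh Lc) j) (diagK fun p c => ∑ κ, ∑' u, colH (GcombSh Lc j) Lc ν y' κ u * (γ j * ctGenM 3 (bhK Lc + Dsh Lc) α Lc κ u p c)))) (GcombSh Lc j))) Lc μ y κ u * (γ j * ctGenM 3 (bhK Lc + Dsh Lc) α Lc κ u p c)) :=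
    ⟨_, _, _, δX, hδX, hXs μ y ν y'⟩
  have hLB : Loc (dM (-(comp (comp (GcombSh Lc j) (conjV (bhKStepSh 3 Lc (Dsh Lc) j) (diagK fun p c => ∑ κ, ∑' u, colH (GcombSh Lc j) Lc ν y' κ u * (γ j * ctGenM 3 (bhK Lc + Dsh Lc) α Lc κ u p c)))) (GcombSh Lc j))) Lc
      (SpureRecOf 3 Lc (symVhSAt (ctr 4 Lc) 3 Lc rfl) (symHessFFAt (ctr 4 Lc) Lc) (GcombSh Lc) ((Lc : ℝ) ^ 4) (-((Lc : ℝ) ^ 8 / 2)) cΛ j) (M1Of 3 Lc (symHessFFAt (ctr 4 Lc) Lc) cΛ j) μ y) :=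
    loc_dM_Xi_dressed (N := Lc) hG hC hm hM hS hM1 hgl μ y ν y'
  obtain ⟨CR, δR, hδR, hRv⟩ := sep_vertex2OfK (N := Lc) hK hR2
  have hLC₁ : Loc (vertex2OfK (GcombSh (d := 3) Lc j) Lc (combR2An1 Lc N cΛ γ (0 : ℕ → Fin 4 → Fin 4 → (Fin 4 → ℤ) → Fin 4 → (Fin 4 → ℤ) → (Fin 4 → ℤ) → Fib 3 → ℝ) j α) μ y ν y') :=
    ⟨_, _, _, δR, hδR, hRv μ y ν y'⟩
  obtain ⟨CMx, δMx, hδMx, hMv⟩ := sep_mixOfK (N := Lc) hK (locStencilFM_symRMrAn1 (Lc := Lc) cΛ γ j α)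
  obtain ⟨CMx', δMx', hδMx', hMv'⟩ := sep_mixOfK_swap (N := Lc) hK (locStencilFM_symRMrAn1 (Lc := Lc) cΛ γ j α)
  have hLC₂ : Loc (mixOfK (GcombSh (d := 3) Lc j) Lc (symRMrAn1 Lc cΛ γ j α) μ y ν y') := ⟨_, _, _, δMx, hδMx, hMv μ y ν y'⟩
  have hLC₃ : Loc (mixOfK (GcombSh (d := 3) Lc j) Lc (symRMrAn1 Lc cΛ γ j α) ν y' μ y) := ⟨_, _, _, δMx', hδMx', hMv' μ y ν y'⟩
  -- the explicit form of the defect, regrouped: (contact mismatch) + (contact-kernel vertex) + (slots)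
  have e : combΔAn1 Lc N cΛ γ (0 : ℕ → Fin 4 → Fin 4 → (Fin 4 → ℤ) → Fin 4 → (Fin 4 → ℤ) → (Fin 4 → ℤ) → Fib 3 → ℝ) j α μ y ν y' =
      combΔOfAt Lc N cΛ γ 0 j (combR2An1 Lc N cΛ γ 0 j) α μ y ν y' := rfl
  have halg : ∀ (A B C D : MKer 4 (Fib 3)), A + B + C - D = (A - D) + B + C := fun _ _ _ _ => by abel
  rw [e, combΔOfAt_eq_sharp (Lc := Lc) N cΛ γ 0 j (Rj := combR2An1 Lc N cΛ γ 0 j) α hR2 μ y ν y', halg, conjW_sub_conjW, diagK_zeroTable,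
    conjV_zero, sub_zero]
  -- split the tadpole and kill three of the four words
  rw [tadpole_add hA ((loc_conjV hM hLX).add hLB) (hLC₁.add (hLC₂.add hLC₃)), tadpole_add hA (loc_conjV hM hLX) hLB,
    tadpole_add hA hLC₁ (hLC₂.add hLC₃), tadpole_add hA hLC₂ hLC₃, tadpole_conjV_bhKStepSh_diagK_eq_zero j hLX,
    tadpole_dM_SpureRecOf_eq_zero cΛ j _ μ y hLB, tadpole_mixOfK_symRMrAn1_eq_zero (hw j) α μ y ν y',
    tadpole_mixOfK_symRMrAn1_eq_zero (hw j) α ν y' μ y]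
  ring

/-- [folklore] **ROOT M″'s REMAINDER TADPOLE IS HALF THE SYMMETRISED T2-REMAINDER SLOT TADPOLE** (at the pin and the weight lock). -/
theorem tadpole_Rm_pinned_eq {cΛ : ℝ} {γ : ℕ → ℝ} (hw : ∀ j, cΛ * wM1 3 Lc j * γ j = -wM2 3 Lc j) (N j : ℕ) (α μ : Fin 4) (y : Fin 4 → ℤ)
    (ν : Fin 4) (y' : Fin 4 → ℤ) :
    tadpole (GcombSh Lc j)
        ((1 / 2 : ℝ) • conjV (bhKStepSh 3 Lc (Dsh Lc) j) (diagK fun p a => (0 : ℕ → Fin 4 → Fin 4 → (Fin 4 → ℤ) → Fin 4 → (Fin 4 → ℤ) → (Fin 4 → ℤ) → Fib 3 → ℝ) j α ν y' μ y p a - (0 : ℕ → Fin 4 → Fin 4 → (Fin 4 → ℤ) → Fin 4 → (Fin 4 → ℤ) → (Fin 4 → ℤ) → Fib 3 → ℝ) j α μ y ν y' p a) +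
          (1 / 2 : ℝ) • (combΔAn1 Lc N cΛ γ (0 : ℕ → Fin 4 → Fin 4 → (Fin 4 → ℤ) → Fin 4 → (Fin 4 → ℤ) → (Fin 4 → ℤ) → Fib 3 → ℝ) j α μ y ν y' +
            combΔAn1 Lc N cΛ γ (0 : ℕ → Fin 4 → Fin 4 → (Fin 4 → ℤ) → Fin 4 → (Fin 4 → ℤ) → (Fin 4 → ℤ) → Fib 3 → ℝ) j α ν y' μ y)) =
      (1 / 2 : ℝ) * (tadpole (GcombSh Lc j) (vertex2OfK (GcombSh (d := 3) Lc j) Lc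
          (combR2An1 Lc N cΛ γ (0 : ℕ → Fin 4 → Fin 4 → (Fin 4 → ℤ) → Fin 4 → (Fin 4 → ℤ) → (Fin 4 → ℤ) → Fib 3 → ℝ) j α) μ y ν y') +
        tadpole (GcombSh Lc j) (vertex2OfK (GcombSh (d := 3) Lc j) Lc
          (combR2An1 Lc N cΛ γ (0 : ℕ → Fin 4 → Fin 4 → (Fin 4 → ℤ) → Fin 4 → (Fin 4 → ℤ) → (Fin 4 → ℤ) → Fib 3 → ℝ) j α) ν y' μ y)) := by
  have hA : Spr (GcombSh (d := 3) Lc j) := spr_GcombSh (d := 3) (Lc := Lc) j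
  have hΔ := hΔL_pinned (Lc := Lc) N cΛ γ
  rw [diagK_zeroTable_sub, conjV_zero, smul_zero, zero_add, tadpole_smul, tadpole_add hA (hΔ j α μ y ν y') (hΔ j α ν y' μ y),
    tadpole_combΔAn1_pinned_eq hw N j α μ y ν y', tadpole_combΔAn1_pinned_eq hw N j α ν y' μ y]

/-- [folklore] **ROOT M″'s SCALAR `hRm0` FROM THE T2-REMAINDER SLOT IDENTITY ALONE** (the displayed `γ_j`, the lock `hΛ : cΛ·Lc⁴ = 2`):
`hR2tad : ∀ j α μ y ν y′, tadpole G′_j (vertex2OfK G′_j Lc (combR2An1 … j α) μ y ν y′) + tadpole G′_j (vertex2OfK … ν y′ μ y) = 0` ⟹ `hRm0` VERBATIM. -/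
theorem hRm0_of_hR2tad {cΛ : ℝ} (hΛ : cΛ * (Lc : ℝ) ^ 4 = 2) (N : ℕ)
    (hR2tad : ∀ (j : ℕ) (α μ : Fin 4) (y : Fin 4 → ℤ) (ν : Fin 4) (y' : Fin 4 → ℤ),
      tadpole (GcombSh Lc j) (vertex2OfK (GcombSh (d := 3) Lc j) Lc
          (combR2An1 Lc N cΛ (fun j => -((Lc : ℝ) ^ 8 / 2) * wVH 3 Lc j / (stepScale 3 Lc j * (Lc : ℝ) ^ 4)) (0 : ℕ → Fin 4 → Fin 4 → (Fin 4 → ℤ) → Fin 4 → (Fin 4 → ℤ) → (Fin 4 → ℤ) → Fib 3 → ℝ) j α) μ y ν y') +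
        tadpole (GcombSh Lc j) (vertex2OfK (GcombSh (d := 3) Lc j) Lc
          (combR2An1 Lc N cΛ (fun j => -((Lc : ℝ) ^ 8 / 2) * wVH 3 Lc j / (stepScale 3 Lc j * (Lc : ℝ) ^ 4)) (0 : ℕ → Fin 4 → Fin 4 → (Fin 4 → ℤ) → Fin 4 → (Fin 4 → ℤ) → (Fin 4 → ℤ) → Fib 3 → ℝ) j α) ν y' μ y) = 0) :
    ∀ (j : ℕ) (α μ : Fin 4) (y : Fin 4 → ℤ) (ν : Fin 4) (y' : Fin 4 → ℤ),
      tadpole (GcombSh Lc j)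
        ((1 / 2 : ℝ) • conjV (bhKStepSh 3 Lc (Dsh Lc) j) (diagK fun p a => (0 : ℕ → Fin 4 → Fin 4 → (Fin 4 → ℤ) → Fin 4 → (Fin 4 → ℤ) → (Fin 4 → ℤ) → Fib 3 → ℝ) j α ν y' μ y p a - (0 : ℕ → Fin 4 → Fin 4 → (Fin 4 → ℤ) → Fin 4 → (Fin 4 → ℤ) → (Fin 4 → ℤ) → Fib 3 → ℝ) j α μ y ν y' p a) +
          (1 / 2 : ℝ) • (combΔAn1 Lc N cΛ (fun j => -((Lc : ℝ) ^ 8 / 2) * wVH 3 Lc j / (stepScale 3 Lc j * (Lc : ℝ) ^ 4)) (0 : ℕ → Fin 4 → Fin 4 → (Fin 4 → ℤ) → Fin 4 → (Fin 4 → ℤ) → (Fin 4 → ℤ) → Fib 3 → ℝ) j α μ y ν y' + combΔAn1 Lc N cΛ (fun j => -((Lc : ℝ) ^ 8 / 2) * wVH 3 Lc j / (stepScale 3 Lc j * (Lc : ℝ) ^ 4)) (0 : ℕ → Fin 4 → Fin 4 → (Fin 4 → ℤ) → Fin 4 → (Fin 4 → ℤ) → (Fin 4 → ℤ) → Fib 3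 → ℝ) j α ν y' μ y)) = 0 := by
  intro j α μ y ν y'
  rw [tadpole_Rm_pinned_eq (fun j' => lock_of_hΛ hΛ j') N j α μ y ν y', hR2tad j α μ y ν y', mul_zero]

/-! ## §6 ROOT M″ WITH THE SCALAR REDUCED TO THE T2-REMAINDER SLOT -/

/-- **ROW D1, CHART (III′) — ROOT M″ WITH `hRm0` REPLACED BY THE T2-REMAINDER SLOT IDENTITY `hR2tad`:
`D1Drift ⟸ hΛ ∧ hcB ∧ hR2tad ∧ D1Tel ∧ D1Rep`** (+ the route theorem's own binders) — ROOT M″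
`CombChartJointEndReflTablesAn1S2N.d1Drift_JsB12CombShSym_an1TablesS2_pinned_of_locks_hcomp_D1Tel_D1Rep` with its `hRm0` supplied by §5 `hRm0_of_hR2tad`.
`hR2tad` is DISPLAYED, NOT claimed: it is the SAME open scalar as `hRm0` (equivalent at the lock by §5 — the three other words of the remainder are
tadpole-null theorems), now read on ONE table, an2's `combR2An1`.  HONEST: composition by name; a REDUCTION of the displayed scalar, not a discharge;
row-D1 binders 0∕4; RECORD unchanged (the referee's to name); NOT D1, NOT `BetaPertH`, NOT continuum, NOT Clay. -/
theorem d1Drift_JsB12CombShSym_an1TablesS2_pinned_of_locks_hR2tad_D1Tel_D1Rep (hLc : Odd Lc) (hL2 : 2 ≤ Lc) {N : ℕ} (hN : 2 ≤ N) (cΛ cB : ℝ)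
    -- the two unit locks of an1's TABLE-FIT tier 2
    (hΛ : cΛ * (Lc : ℝ) ^ 4 = 2) (hcB : cB = -((Lc : ℝ) ^ 12 / 4))
    -- the T2-REMAINDER SLOT IDENTITY: the symmetrised tadpole of the bi-vertex of `combR2An1 … j α` against `G′_j` vanishes (OPEN; (E0)'s object by §5)
    (hR2tad : ∀ (j : ℕ) (α μ : Fin 4) (y : Fin 4 → ℤ) (ν : Fin 4) (y' : Fin 4 → ℤ),
      tadpole (GcombSh Lc j) (vertex2OfK (GcombSh (d := 3) Lc j) Lc
          (combR2An1 Lc N cΛ (fun j => -((Lc : ℝ) ^ 8 / 2) * wVH 3 Lc j / (stepScale 3 Lc j * (Lc : ℝ) ^ 4)) (0 : ℕ → Fin 4 → Fin 4 → (Fin 4 → ℤ) → Fin 4 → (Fin 4 → ℤ) → (Fin 4 → ℤ) → Fib 3 → ℝ) j α) μ y ν y') +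
        tadpole (GcombSh Lc j) (vertex2OfK (GcombSh (d := 3) Lc j) Lc
          (combR2An1 Lc N cΛ (fun j => -((Lc : ℝ) ^ 8 / 2) * wVH 3 Lc j / (stepScale 3 Lc j * (Lc : ℝ) ^ 4)) (0 : ℕ → Fin 4 → Fin 4 → (Fin 4 → ℤ) → Fin 4 → (Fin 4 → ℤ) → (Fin 4 → ℤ) → Fib 3 → ℝ) j α) ν y' μ y) = 0)
    -- the route theorem's own binders, verbatim
    (a : ℝ) (ha : 0 < a)
    (h12 : B5.Prop12Printed (fam (fun i : ℕ+ × ℕ => ((i.1 : ℕ+) : ℕ)) (fun i => i.1.pos) MvE a ha))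
    (h126 : B5.Kernel126_127Printed (kfam (fun i : ℕ+ × ℕ => ((i.1 : ℕ+) : ℕ)) MvE))
    {L : Type*} {SL : Finset L} (hSL : SL.Nonempty) (k : L → Fin 4) {μ ν : Fin 4} (hμν : μ ≠ ν) {Nc : ℝ} (hNc : Nc ≠ 0)
    (Jc : ∀ m : ℕ, JetData 3 (Lc ^ m))
    (htel : D1Tel Lc (JsB12CombShSym hLc N (symTablesAn1S2 3 Lc cΛ) cΛ cB) Jc)
    {cc : ℝ} {Mw' : ℕ → ℕ} (hc : 1 ≤ cc) (hMwin : ∀ L : ℕ, 2 ≤ L → 1 ≤ Mw' L ∧ (L : ℝ) ≤ cc * Mw' L) (hML : ∀ L : ℕ, 2 ≤ L → Mw' L ≤ L)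
    (hrep : D1Rep Lc Jc Nc μ ν a SL k) :
    D1Drift Lc (JsB12CombShSym hLc N (symTablesAn1S2 3 Lc cΛ) cΛ cB) Nc μ ν :=
  d1Drift_JsB12CombShSym_an1TablesS2_pinned_of_locks_hcomp_D1Tel_D1Rep hLc hL2 hN cΛ cB hΛ hcB (hRm0_of_hR2tad (Lc := Lc) hΛ N hR2tad)
    a ha h12 h126 hSL k hμν hNc Jc htel hc hMwin hML hrep

end Summit.QuantumFields.BalabanUV.Beta.CombRemainderTadpoleSlot

end
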